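import Mathlib
import Literature.MathematicalPhysics.QuantumLattice.GermMarkov
import Literature.MathematicalPhysics.QuantumLattice.BallSpecification
import Literature.MathematicalPhysics.QuantumLattice.LatticeScalarField
import Literature.Probability.LatticeModels.GibbsSpecificationProofs
import Literature.Probability.LatticeModels.GibbsSpecificationDLRProofs
import HarnessLib

/-!
# Lattice spin fields are Markov across every spherical shell thicker than the mesh

Topic `MathematicalPhysics/QuantumLattice` (random fields on `𝓢'(ℝᵈ)`, files `RandomField`,
`GermMarkov`, `BallSpecification`, `LatticeScalarField`): THEOREM-ONLY support file, requested by the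
route `CriticalPhenomena/Ising3DConformalLimit/BallSpecification` (crux `BallSpecifiedFieldLimit`, stub
`stub_thickShellMarkov`, the provable lattice half of the Markov-inheritance node).

**Main result** (`condIndepCondExp_shell_spinFieldLaw_isingMeasure`). Let
`ν = μ^{ηbc}_{Λ;β,h}` be the finite-volume Ising measure of `ℤᵈ` in the volume `Λ` with the boundary
condition fixed to `ηbc` (`isingMeasure (zdGraph d) Λ β h (.fixed ηbc)`, any real `β`, `h`), let
`0 < δ < ε`, `ρ ≠ 0`, and let `μ_δ = spinFieldLaw ν Λ δ ρ` be the law on `FieldConfig ℝᵈ = 𝓢'(ℝᵈ)` of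
the smeared spin field `Φ_δ(σ) = ρ δᵈ ∑_{x ∈ Λ} σ_x δ_{δx}`. Then for every centre `c` and radius `r`,
the events inside the open ball `B(c, r)` (`extEvents (ball c r)`) and the events outside the closed
ball `B̄(c, r + ε/2)` (`extEvents (closedBall c (r + ε/2))ᶜ`) are conditionally independent under
`μ_δ` given the events in the open shell `B(c, r + ε) ∖ B̄(c, r)`, in the conditional-expectation
form `CondIndepCondExp` of `GermMarkov.lean`.

**Proof** (Friedli–Velenik 2017, §3.6.3, Exercise 3.11 and eq. (3.26) — the spatial Markov property
of the nearest-neighbour specification — made quantitative at mesh `δ` and pushed to `𝓢'`).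
* `condExp_comp_ae_eq_condExp_map_comp`, `CondIndepCondExp.map_of_comap`: conditional expectations,
  hence conditional independence in the `CondIndepCondExp` form, transport along a measurable map
  `Φ` from `(Ω₀, ν)` with the pulled-back σ-algebras `Φ⁻¹ m` to the image measure `ν.map Φ`.
* `condIndepCondExp_of_condExp_version`: if every `A ∈ m₁` has a bounded `m''`-measurable version
  of `μ⟦A | mG⟧`, where `m'' ≤ mG` and `m₂ ≤ mG`, then `m''` splits `m₁` and `m₂` (tower property
  and pull-out; Rozanov 1982, Ch. 2 §1.1).
* `condExp_ae_eq_integral_of_lintegral_eq`: Georgii's conditional-expectation form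
  `μ[f | 𝓕_{Λᶜ}] = γ_Λ f` of the DLR equation for ONE volume `Λ` of a specification, from the
  set-wise identity `∫ γ_Λ(A | ·) dμ = μ(A)` for that volume (the tree's
  `IsGibbsMeasure.condExp_ae_eq_integral` verbatim, per volume); for `μ = μ^{ηbc}_Λ` and `I ⊆ Λ`
  this identity is the consistency of the Ising kernels (`lintegral_isingMeasure_fixed_consistent`):
  `condExp_isingMeasure_fixed_ae_eq_integral`.
* `condIndepCondExp_isingMeasure_fixed`: the Markov property of `μ^{ηbc}_Λ` across a sub-volume
  `I ⊆ Λ` — any σ-algebra of events off `I` that sees the boundary spins `σ_y`, `y ∈ ∂ᵉˣI ∩ Λ`,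
  splits the `I`-local events from the events off `I` (`μ^·_I(A)` depends on the boundary condition
  only on `∂ᵉˣI`, `isingExpect_fixed_congr_outerBoundary`, and the spins off `Λ` are a.s. frozen,
  `ae_eqOn_compl_isingMeasure_fixed`).
* Geometry of `δℤᵈ` (`dist_smul_siteToE_of_adj`, `le_dist_smul_siteToE_of_ne`), Schwartz bumps
  (`exists_schwartz_tsupport_subset_ball`, Mathlib `ContDiffBump` + `HasCompactSupport.toSchwartzMap`),
  and the pull-backs of `extEvents U` along `Φ_δ` (`comap_spinField_extEvents_le`: into the spins at
  the sites `x ∈ Λ` with `δx ∈ U`; `measurable_apply_comap_spinField`: a bump of radius `< δ` around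
  `δy` isolates the spin `σ_y`). With `I = {x ∈ Λ : |δx − c| ≤ r}` every site of `∂ᵉˣI ∩ Λ` has
  radius in `(r, r + δ] ⊆ (r, r + ε)`, which assembles the main result.

## References

* S. Friedli, Y. Velenik, *Statistical Mechanics of Lattice Systems*, CUP (2017), §3.6.3
  (Exercise 3.11, eq. (3.26): spatial Markov property), §6.2–6.3 (Lemma 6.7: consistency;
  Lemma 6.13, eq. (6.23): kernels vs. conditional probabilities). [FriedliVelenik2017]
* H.-O. Georgii, *Gibbs Measures and Phase Transitions*, 2nd ed., de Gruyter (2011), Remark 1.20,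
  Def. 1.23, Remark 1.24. [Georgii2011]
* Yu. A. Rozanov, *Markov Random Fields*, Springer (1982), Ch. 2 §1.1 (splitting σ-algebras).
  [Rozanov1982]

## Mathlib

`MeasureTheory.condExp` (`condExp_condExp_of_le`, `condExp_mul_of_stronglyMeasurable_left/right`,
`condExp_of_stronglyMeasurable`, `ae_eq_condExp_of_forall_setIntegral_eq`, `setIntegral_condExp`),
`setIntegral_map`, `ae_map_iff`, `MeasurableSpace.comap_iSup` / `comap_comp`, `cylinderEvents`,
`ProbabilityTheory.Kernel.integral_comp`, `ContDiffBump`, `HasCompactSupport.toSchwartzMap`,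
`PiLp.norm_single`, `PiLp.dist_apply_le`. No transport lemma for `condExp` along `Measure.map` with a
general sub-σ-algebra was found at the pin (the tree's
`Literature.Probability.Process.condExp_comp_of_measurePreserving` is the case `m' = σ(p)`).
-/

noncomputable section

namespace Literature.MathematicalPhysics.QuantumLattice

open _root_.MeasureTheory _root_.ProbabilityTheory Set Filter
open scoped ENNReal ProbabilityTheory SchwartzMap
open Literature.Probability.LatticeModels

/-! ### Transport of conditional expectations and conditional independence along a map -/

section Transport

variable {Ω₀ Ω : Type*} {m₀ : MeasurableSpace Ω₀}

/-- **Conditional expectation of a composite given a pulled-back σ-algebra.** For a finite measure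
`ν` on `Ω₀`, a measurable `Φ : Ω₀ → Ω`, a sub-σ-algebra `m' ≤ mΩ` and `g` integrable for `ν.map Φ`:
`ν[g ∘ Φ | Φ⁻¹ m'] = (ν.map Φ)[g | m'] ∘ Φ` `ν`-a.e. (change of variables in the defining set integrals,
uniqueness of the conditional expectation). [folklore] -/
theorem condExp_comp_ae_eq_condExp_map_comp {m' : MeasurableSpace Ω} {mΩ : MeasurableSpace Ω}
    {ν : Measure Ω₀} [IsFiniteMeasure ν] {Φ : Ω₀ → Ω} (hΦ : Measurable Φ) (hm' : m' ≤ mΩ)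
    {g : Ω → ℝ} (hg : Integrable g (ν.map Φ)) :
    ν[g ∘ Φ | m'.comap Φ] =ᵐ[ν] ((ν.map Φ)[g | m']) ∘ Φ := by
  have hmc : m'.comap Φ ≤ m₀ := (MeasurableSpace.comap_mono hm').trans hΦ.comap_le
  have hΦm : Measurable[m'.comap Φ, m'] Φ := comap_measurable Φ
  have hgΦ : Integrable (g ∘ Φ) ν :=
    (integrable_map_measure hg.aestronglyMeasurable hΦ.aemeasurable).1 hg
  have hc : Integrable ((ν.map Φ)[g | m']) (ν.map Φ) := integrable_condExp
  have hcΦ : Integrable (((ν.map Φ)[g | m']) ∘ Φ) ν :=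
    (integrable_map_measure hc.aestronglyMeasurable hΦ.aemeasurable).1 hc
  refine (ae_eq_condExp_of_forall_setIntegral_eq hmc hgΦ (fun s _ _ => hcΦ.integrableOn) ?_
    ?_).symm
  · rintro _ ⟨S, hS, rfl⟩ -
    have hS' : MeasurableSet S := hm' S hS
    simp only [Function.comp_apply]
    rw [← setIntegral_map hS' hc.aestronglyMeasurable hΦ.aemeasurable,
      ← setIntegral_map hS' hg.aestronglyMeasurable hΦ.aemeasurable]
    exact setIntegral_condExp hm' hg hS
  · exact (stronglyMeasurable_condExp.comp_measurable hΦm).aestronglyMeasurable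

/-- Indicators of preimages are composites of indicators. [folklore] -/
theorem indicator_preimage_one_eq_comp (Φ : Ω₀ → Ω) (s : Set Ω) :
    ((Φ ⁻¹' s).indicator fun _ => (1 : ℝ)) = (s.indicator fun _ => (1 : ℝ)) ∘ Φ := by
  funext x
  exact (Set.indicator_comp_right Φ (g := fun _ => (1 : ℝ))).trans rfl

/-- **Conditional independence transports to the image measure.** If the pulled-back σ-algebras
`Φ⁻¹ m₁`, `Φ⁻¹ m₂` are conditionally independent given `Φ⁻¹ m'` under `ν` (all in the
conditional-expectation form `CondIndepCondExp`), then `m₁`, `m₂` are conditionally independent given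
`m'` under the image measure `ν.map Φ`. [folklore] -/
theorem CondIndepCondExp.map_of_comap {m' m₁ m₂ : MeasurableSpace Ω} {mΩ : MeasurableSpace Ω}
    {ν : Measure Ω₀} [IsFiniteMeasure ν] {Φ : Ω₀ → Ω} (hΦ : Measurable Φ) (hm' : m' ≤ mΩ)
    (hm₁ : m₁ ≤ mΩ) (hm₂ : m₂ ≤ mΩ)
    (h : CondIndepCondExp (m'.comap Φ) (m₁.comap Φ) (m₂.comap Φ) ν) :
    CondIndepCondExp m' m₁ m₂ (ν.map Φ) := by
  intro s t hs ht
  have hs' : MeasurableSet s := hm₁ s hs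
  have ht' : MeasurableSet t := hm₂ t ht
  have hint : ∀ {u : Set Ω}, MeasurableSet u →
      Integrable (u.indicator fun _ => (1 : ℝ)) (ν.map Φ) :=
    fun hu => (integrable_const (1 : ℝ)).indicator hu
  have key := h (Φ ⁻¹' s) (Φ ⁻¹' t) ⟨s, hs, rfl⟩ ⟨t, ht, rfl⟩
  rw [← Set.preimage_inter, indicator_preimage_one_eq_comp, indicator_preimage_one_eq_comp,
    indicator_preimage_one_eq_comp] at key
  have h₁ := condExp_comp_ae_eq_condExp_map_comp hΦ hm' (hint (hs'.inter ht'))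
  have h₂ := condExp_comp_ae_eq_condExp_map_comp hΦ hm' (hint hs')
  have h₃ := condExp_comp_ae_eq_condExp_map_comp hΦ hm' (hint ht')
  have hcomp : ((ν.map Φ)⟦s ∩ t | m'⟧) ∘ Φ =ᵐ[ν]
      ((ν.map Φ)⟦s | m'⟧ * (ν.map Φ)⟦t | m'⟧) ∘ Φ := by
    filter_upwards [key, h₁, h₂, h₃] with x hx hx₁ hx₂ hx₃
    simp only [Function.comp_apply, Pi.mul_apply] at hx hx₁ hx₂ hx₃ ⊢
    rw [← hx₁, hx, hx₂, hx₃]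
  have hmeas : MeasurableSet {ω | ((ν.map Φ)⟦s ∩ t | m'⟧) ω =
      ((ν.map Φ)⟦s | m'⟧ * (ν.map Φ)⟦t | m'⟧) ω} := by
    refine measurableSet_eq_fun ?_ ?_
    · exact (stronglyMeasurable_condExp.mono hm').measurable
    · exact ((stronglyMeasurable_condExp.mono hm').mul
        (stronglyMeasurable_condExp.mono hm')).measurable
  exact (ae_map_iff hΦ.aemeasurable hmeas).2 hcomp

end Transport

/-! ### Conditional independence from a one-sided Markov property -/

section Markov

variable {Ω : Type*}

/-- **Splitting from a measurable version.** Let `μ` be a finite measure, `m'' ≤ mG ≤ mΩ` and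
`m₂ ≤ mG` σ-algebras. If for every `A ∈ m₁` the conditional probability `μ⟦A | mG⟧` has a bounded
`m''`-measurable version `g`, then `m''` splits `m₁` and `m₂`:
`μ⟦A ∩ B | m''⟧ = μ⟦A | m''⟧ μ⟦B | m''⟧` for `A ∈ m₁`, `B ∈ m₂` (tower property and pull-out).
This is the mechanism "one-sided Markov property ⇒ the boundary σ-algebra splits the inside from the
outside" (Rozanov 1982, Ch. 2 §1.1, splitting; Friedli–Velenik 2017, eq. (3.26)). [folklore] -/
theorem condIndepCondExp_of_condExp_version {m'' mG m₁ m₂ : MeasurableSpace Ω}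
    {mΩ : MeasurableSpace Ω} {μ : Measure Ω} [IsFiniteMeasure μ] (hm''G : m'' ≤ mG) (hG : mG ≤ mΩ)
    (hm₁ : m₁ ≤ mΩ) (hm₂ : m₂ ≤ mG)
    (hver : ∀ A, MeasurableSet[m₁] A → ∃ g : Ω → ℝ, StronglyMeasurable[m''] g ∧
      (∃ C, ∀ ω, |g ω| ≤ C) ∧ μ⟦A | mG⟧ =ᵐ[μ] g) :
    CondIndepCondExp m'' m₁ m₂ μ := by
  intro A B hA hB
  have hm'' : m'' ≤ mΩ := hm''G.trans hG
  obtain ⟨g, hgm, ⟨C, hC⟩, hgA⟩ := hver A hA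
  have hA' : MeasurableSet A := hm₁ A hA
  have hB' : MeasurableSet B := hG B (hm₂ B hB)
  set iA : Ω → ℝ := A.indicator fun _ => (1 : ℝ) with hiA
  set iB : Ω → ℝ := B.indicator fun _ => (1 : ℝ) with hiB
  have hiA_int : Integrable iA μ := (integrable_const (1 : ℝ)).indicator hA'
  have hiB_int : Integrable iB μ := (integrable_const (1 : ℝ)).indicator hB'
  have hiB_G : StronglyMeasurable[mG] iB :=
    (stronglyMeasurable_const.indicator (hm₂ B hB))
  have hg_int : Integrable g μ :=
    Integrable.of_bound (hgm.mono hm'').aestronglyMeasurable C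
      (ae_of_all _ fun ω => by rw [Real.norm_eq_abs]; exact hC ω)
  -- the indicator of `A ∩ B` is the product of indicators
  have hAB : ((A ∩ B).indicator fun _ => (1 : ℝ)) = iA * iB := by
    funext ω
    simp only [hiA, hiB, Pi.mul_apply]
    by_cases hωA : ω ∈ A
    · by_cases hωB : ω ∈ B
      · rw [Set.indicator_of_mem (Set.mem_inter hωA hωB), Set.indicator_of_mem hωA,
          Set.indicator_of_mem hωB, mul_one]
      · rw [Set.indicator_of_notMem (fun h : ω ∈ A ∩ B => hωB h.2), Set.indicator_of_notMem hωB,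
          mul_zero]
    · rw [Set.indicator_of_notMem (fun h : ω ∈ A ∩ B => hωA h.1), Set.indicator_of_notMem hωA,
        zero_mul]
  have hAB_int : Integrable (iA * iB) μ := by
    rw [← hAB]; exact (integrable_const (1 : ℝ)).indicator (hA'.inter hB')
  have hgB_int : Integrable (g * iB) μ := by
    refine Integrable.of_bound ((hgm.mono hm'').mul (hiB_G.mono hG)).aestronglyMeasurable C
      (ae_of_all _ fun ω => ?_)
    simp only [Pi.mul_apply, hiB, norm_mul, Real.norm_eq_abs]
    by_cases hω : ω ∈ B
    · rw [Set.indicator_of_mem hω, abs_one, mul_one]; exact hC ω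
    · rw [Set.indicator_of_notMem hω, abs_zero, mul_zero]; exact (abs_nonneg _).trans (hC ω)
  -- (1) `μ[iA iB | m''] = μ[ μ[iA iB | mG] | m'']`
  have h1 : μ[iA * iB | m''] =ᵐ[μ] μ[μ[iA * iB | mG] | m''] :=
    (condExp_condExp_of_le hm''G hG).symm
  -- (2) pull out `iB` (which is `mG`-measurable): `μ[iA iB | mG] = μ[iA | mG] iB`
  have h2 : μ[iA * iB | mG] =ᵐ[μ] μ[iA | mG] * iB :=
    condExp_mul_of_stronglyMeasurable_right hiB_G hAB_int hiA_int
  -- (3) replace `μ[iA | mG]` by its version `g`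
  have h3 : μ[iA | mG] * iB =ᵐ[μ] g * iB := by
    filter_upwards [hgA] with ω hω
    simp only [Pi.mul_apply, hω]
  have h4 : μ[μ[iA * iB | mG] | m''] =ᵐ[μ] μ[g * iB | m''] := condExp_congr_ae (h2.trans h3)
  -- (5) pull out `g` (which is `m''`-measurable)
  have h5 : μ[g * iB | m''] =ᵐ[μ] g * μ[iB | m''] :=
    condExp_mul_of_stronglyMeasurable_left hgm hgB_int hiB_int
  -- (6) `μ[iA | m''] = μ[μ[iA | mG] | m''] = μ[g | m''] = g`
  have h6 : μ[iA | m''] =ᵐ[μ] g := by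
    calc μ[iA | m''] =ᵐ[μ] μ[μ[iA | mG] | m''] := (condExp_condExp_of_le hm''G hG).symm
      _ =ᵐ[μ] μ[g | m''] := condExp_congr_ae hgA
      _ = g := condExp_of_stronglyMeasurable hm'' hgm hg_int
  rw [hAB]
  calc μ[iA * iB | m''] =ᵐ[μ] μ[μ[iA * iB | mG] | m''] := h1
    _ =ᵐ[μ] μ[g * iB | m''] := h4
    _ =ᵐ[μ] g * μ[iB | m''] := h5
    _ =ᵐ[μ] μ[iA | m''] * μ[iB | m''] := by
        filter_upwards [h6] with ω hω
        simp only [Pi.mul_apply, hω]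

end Markov


/-! ### Finite-volume DLR equations in conditional-expectation form -/

section FiniteVolumeDLR

variable {V S : Type*} [MeasurableSpace S] {γ : Specification V S}

/-- **Per-volume DLR identity for observables**: if a finite measure `μ` satisfies the DLR identity
`∫ γ_Λ(A | η) dμ(η) = μ(A)` for ONE finite volume `Λ` of a specification `γ`, then
`∫ (γ_Λ f) dμ = ∫ f dμ` for every `μ`-integrable `f` (Friedli–Velenik 2017, Exercise 6.6 with
eq. (6.20); the proof of `IsGibbsMeasure.integral_integral_eq` uses only this one volume).
[cite: FriedliVelenik2017, Exercise 6.6] -/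
theorem integral_integral_eq_of_lintegral_eq (hγ : IsSpecification γ) {μ : Measure (V → S)}
    (Λ : Finset V) (hDLR : ∀ A : Set (V → S), MeasurableSet A → ∫⁻ η, γ Λ η A ∂μ = μ A)
    {f : (V → S) → ℝ} (hf : Integrable f μ) :
    ∫ η, ∫ σ, f σ ∂(γ Λ η) ∂μ = ∫ σ, f σ ∂μ := by
  -- adapted from `Literature.Probability.LatticeModels.IsGibbsMeasure.integral_integral_eq`
  have hbind : μ.bind (γ Λ) = μ := by
    ext A hA
    rw [Measure.bind_apply hA (hγ.measurable_fun Λ).aemeasurable]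
    exact hDLR A hA
  let κ : Kernel (V → S) (V → S) := ⟨γ Λ, hγ.measurable_fun Λ⟩
  have hcomp : (κ ∘ₖ Kernel.const Unit μ) () = μ := by
    rw [Kernel.comp_apply, Kernel.const_apply]
    exact hbind
  have hfi : Integrable f ((κ ∘ₖ Kernel.const Unit μ) ()) := by rwa [hcomp]
  have key := Kernel.integral_comp hfi
  rw [hcomp, Kernel.const_apply] at key
  exact key.symm

/-- **Per-volume DLR equations in Georgii's conditional-expectation form**: if a probability
measure `μ` satisfies `∫ γ_Λ(A | η) dμ(η) = μ(A)` for one finite volume `Λ` of a specification `γ`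
(e.g. `μ = γ_{Λ'}(· | η)` with `Λ ⊆ Λ'`, by consistency), then `μ[f | 𝓕_{Λᶜ}] = γ_Λ f` `μ`-a.s.
for every bounded measurable `f` (Georgii 2011, Remark 1.20 and Remark 1.24; Friedli–Velenik 2017,
§6.3.1, eq. (6.23), whose printed proof uses only the volume `Λ`; the tree's
`IsGibbsMeasure.condExp_ae_eq_integral` is the case of a Gibbs measure).
[cite: FriedliVelenik2017, §6.3.1 eq. (6.23)] -/
theorem condExp_ae_eq_integral_of_lintegral_eq (hγ : IsSpecification γ) {μ : Measure (V → S)}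
    [IsProbabilityMeasure μ] (Λ : Finset V)
    (hDLR : ∀ A : Set (V → S), MeasurableSet A → ∫⁻ η, γ Λ η A ∂μ = μ A)
    {f : (V → S) → ℝ} (hf : Measurable f) {C : ℝ} (hC : ∀ σ, |f σ| ≤ C) :
    μ[f | cylinderEvents (X := fun _ : V => S) ((↑Λ : Set V)ᶜ)] =ᵐ[μ]
      fun η => ∫ σ, f σ ∂(γ Λ η) := by
  -- adapted from `Literature.Probability.LatticeModels.IsGibbsMeasure.condExp_ae_eq_integral`
  have hm : cylinderEvents (X := fun _ : V => S) ((↑Λ : Set V)ᶜ) ≤ MeasurableSpace.pi :=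
    cylinderEvents_le_pi
  have hC' : ∀ σ, ‖f σ‖ ≤ C := fun σ => by rw [Real.norm_eq_abs]; exact hC σ
  have hgm : StronglyMeasurable[cylinderEvents (X := fun _ : V => S) ((↑Λ : Set V)ᶜ)]
      (fun η => ∫ σ, f σ ∂(γ Λ η)) :=
    hf.stronglyMeasurable.integral_kernel (κ := hγ.toKernel Λ)
  have hgb : ∀ η, ‖∫ σ, f σ ∂(γ Λ η)‖ ≤ C := fun η => by
    haveI := hγ.isProbability Λ η
    simpa using norm_integral_le_of_norm_le_const (μ := γ Λ η) (ae_of_all _ hC')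
  have hg_int : Integrable (fun η => ∫ σ, f σ ∂(γ Λ η)) μ :=
    (integrable_const C).mono' (hgm.mono hm).aestronglyMeasurable (ae_of_all _ hgb)
  have hf_int : Integrable f μ :=
    (integrable_const C).mono' hf.aestronglyMeasurable (ae_of_all _ hC')
  refine (ae_eq_condExp_of_forall_setIntegral_eq hm hf_int (fun s _ _ => hg_int.integrableOn)
    (fun s hs _ => ?_) hgm.aestronglyMeasurable).symm
  have hs' : MeasurableSet s := hm s hs
  have hprop : ∀ η, ∫ σ, s.indicator f σ ∂(γ Λ η) =
      s.indicator (fun ζ => ∫ σ, f σ ∂(γ Λ ζ)) η := by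
    intro η
    by_cases hη : η ∈ s
    · rw [Set.indicator_of_mem hη]
      refine integral_congr_ae ?_
      filter_upwards [hγ.ae_mem_iff_mem Λ hs η] with σ hσ
      rw [Set.indicator_of_mem (hσ.2 hη)]
    · rw [Set.indicator_of_notMem hη, ← integral_zero (V → S) ℝ]
      refine integral_congr_ae ?_
      filter_upwards [hγ.ae_mem_iff_mem Λ hs η] with σ hσ
      rw [Set.indicator_of_notMem fun h => hη (hσ.1 h)]
  calc ∫ η in s, (∫ σ, f σ ∂(γ Λ η)) ∂μ
      = ∫ η, s.indicator (fun ζ => ∫ σ, f σ ∂(γ Λ ζ)) η ∂μ := (integral_indicator hs').symm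
    _ = ∫ η, ∫ σ, s.indicator f σ ∂(γ Λ η) ∂μ := by
        refine integral_congr_ae (ae_of_all _ fun η => ?_)
        exact (hprop η).symm
    _ = ∫ σ, s.indicator f σ ∂μ :=
        integral_integral_eq_of_lintegral_eq hγ Λ hDLR (hf_int.indicator hs')
    _ = ∫ σ in s, f σ ∂μ := integral_indicator hs'

end FiniteVolumeDLR

/-! ### The finite-volume Ising measure: DLR for sub-volumes and the Markov property -/

section IsingMarkov

variable {V : Type*} [Countable V] (G : SimpleGraph V) [DecidableEq V] [G.LocallyFinite]

/-- **Finite-volume DLR equations for sub-volumes** (Friedli–Velenik 2017, Lemma 6.7 with §6.3.1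
eq. (6.23); Georgii 2011, Remark 1.24): for `I ⊆ Λ` and a bounded measurable `f`,
`μ^η_{Λ;β,h}[f | 𝓕_{Iᶜ}] = (ζ ↦ ∫ f dμ^ζ_{I;β,h})` `μ^η_Λ`-a.s. (consistency of the Ising kernels
`lintegral_isingMeasure_fixed_consistent` is exactly the DLR identity of `μ^η_Λ` for the volume
`I`). [cite: FriedliVelenik2017, Lemma 6.7] -/
theorem condExp_isingMeasure_fixed_ae_eq_integral {I Λ : Finset V} (hsub : I ⊆ Λ) (β h : ℝ)
    (ηbc : SpinConfig V) {f : SpinConfig V → ℝ} (hf : Measurable f) {C : ℝ}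
    (hC : ∀ σ, |f σ| ≤ C) :
    (isingMeasure G Λ β h (.fixed ηbc))[f | cylinderEvents (X := fun _ : V => ℤˣ) ((↑I : Set V)ᶜ)]
      =ᵐ[isingMeasure G Λ β h (.fixed ηbc)]
      fun η => ∫ σ, f σ ∂(isingMeasure G I β h (.fixed η)) :=
  condExp_ae_eq_integral_of_lintegral_eq (γ := isingSpecification G β h)
    (isSpecification_isingSpecification_holds G β h) I
    (fun _ hA => lintegral_isingMeasure_fixed_consistent G hsub β h ηbc hA) hf hC

omit [Countable V] in
/-- Freezing a configuration to `ηbc` off `Λ`. [folklore] -/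
theorem freeze_eq_self_of_eqOn {Λ : Finset V} {ηbc η : SpinConfig V}
    (hη : ∀ x ∉ Λ, η x = ηbc x) :
    (fun x => if x ∈ Λ then η x else ηbc x) = η := by
  funext x
  by_cases hx : x ∈ Λ
  · rw [if_pos hx]
  · rw [if_neg hx, hη x hx]

omit [Countable V] [DecidableEq V] in
/-- An event of `𝓕_Δ = cylinderEvents Δ` is determined by the coordinates in `Δ`. [folklore] -/
theorem mem_iff_mem_of_measurableSet_cylinderEvents {S : Type*} [MeasurableSpace S] {Δ : Set V}
    {A : Set (V → S)} (hA : MeasurableSet[cylinderEvents (X := fun _ : V => S) Δ] A)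
    {σ τ : V → S} (h : ∀ x ∈ Δ, σ x = τ x) : σ ∈ A ↔ τ ∈ A := by
  -- adapted from `Literature.Probability.LatticeModels.IsSpecification.ae_mem_iff_mem`
  have hle : cylinderEvents (X := fun _ : V => S) Δ ≤
      MeasurableSpace.comap (fun σ : V → S => Set.restrict Δ σ) ⊤ := by
    refine iSup₂_le fun x hx => ?_
    have hcomp : (fun σ : V → S => σ x) = (fun g : Δ → S => g ⟨x, hx⟩) ∘
        fun σ : V → S => Set.restrict Δ σ := rfl
    rw [hcomp, ← MeasurableSpace.comap_comp]
    exact MeasurableSpace.comap_mono le_top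
  rcases hle _ hA with ⟨t, -, rfl⟩
  have hr : Set.restrict Δ σ = Set.restrict Δ τ := funext fun x => h x x.2
  simp only [Set.mem_preimage, hr]

/-- **Markov property of the finite-volume Ising measure across a sub-volume** (Friedli–Velenik
2017, Exercise 3.11 / eq. (3.26), the "spatial Markov property"; Georgii 2011, Remark 1.24 with the
nearest-neighbour locality of Ex. 2.12): let `I ⊆ Λ` be finite volumes of a locally finite graph on a
countable vertex set and `ν = μ^{ηbc}_{Λ;β,h}`. If a σ-algebra `m''` of events outside `I` makes every
boundary spin `σ_y`, `y ∈ ∂ᵉˣI ∩ Λ`, measurable, then `m''` splits every σ-algebra `m₁` of events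
inside `I` from every σ-algebra `m₂` of events outside `I`:
`ν⟦A ∩ B | m''⟧ = ν⟦A | m''⟧ ν⟦B | m''⟧` a.s. Proof: `ν[1_A | 𝓕_{Iᶜ}] = μ^·_I(A)` (finite-volume DLR,
`condExp_isingMeasure_fixed_ae_eq_integral`), which depends on the boundary condition only through
`∂ᵉˣI` (`isingExpect_fixed_congr_outerBoundary`), where the spins off `Λ` are `ν`-a.s. frozen to `ηbc`
(`ae_eqOn_compl_isingMeasure_fixed`); so it has an `m''`-measurable version, and the tower and
pull-out properties conclude (`condIndepCondExp_of_condExp_version`). [cite: FriedliVelenik2017, Exercise 3.11, eq. (3.26)] -/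
theorem condIndepCondExp_isingMeasure_fixed {I Λ : Finset V} (hsub : I ⊆ Λ) (β h : ℝ)
    (ηbc : SpinConfig V) {m'' m₁ m₂ : MeasurableSpace (SpinConfig V)}
    (hm'' : m'' ≤ cylinderEvents (X := fun _ : V => ℤˣ) ((↑I : Set V)ᶜ))
    (hbd : ∀ y ∈ outerBoundary G I, y ∈ Λ → Measurable[m''] fun η : SpinConfig V => η y)
    (hm₁ : m₁ ≤ cylinderEvents (X := fun _ : V => ℤˣ) (↑I : Set V))
    (hm₂ : m₂ ≤ cylinderEvents (X := fun _ : V => ℤˣ) ((↑I : Set V)ᶜ)) :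
    CondIndepCondExp m'' m₁ m₂ (isingMeasure G Λ β h (.fixed ηbc)) := by
  classical
  -- the ambient (product) σ-algebra, re-declared so that it is the preferred instance
  letI mpi : MeasurableSpace (SpinConfig V) := MeasurableSpace.pi
  set ν := isingMeasure G Λ β h (.fixed ηbc) with hν
  refine condIndepCondExp_of_condExp_version hm'' cylinderEvents_le_pi
    (hm₁.trans cylinderEvents_le_pi) hm₂ fun A hA => ?_
  have hAI : MeasurableSet[cylinderEvents (X := fun _ : V => ℤˣ) (↑I : Set V)] A := hm₁ A hA
  have hA' : MeasurableSet A := cylinderEvents_le_pi A hAI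
  -- the indicator of `A`, a bounded measurable `I`-local observable
  set χ : SpinConfig V → ℝ := A.indicator fun _ => (1 : ℝ) with hχ
  have hχm : Measurable χ := measurable_const.indicator hA'
  have hχb : ∀ σ, |χ σ| ≤ 1 := fun σ => by
    by_cases hσ : σ ∈ A
    · simp [hχ, Set.indicator_of_mem hσ]
    · simp [hχ, Set.indicator_of_notMem hσ]
  have hχloc : ∀ σ σ' : SpinConfig V, (∀ x ∈ I, σ x = σ' x) → χ σ = χ σ' := by
    intro σ σ' hσσ'
    have hiff : σ ∈ A ↔ σ' ∈ A :=
      mem_iff_mem_of_measurableSet_cylinderEvents hAI fun x hx => hσσ' x (Finset.mem_coe.1 hx)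
    by_cases hσ : σ ∈ A
    · rw [hχ, Set.indicator_of_mem hσ, Set.indicator_of_mem (hiff.1 hσ)]
    · rw [hχ, Set.indicator_of_notMem hσ, Set.indicator_of_notMem fun h' => hσ (hiff.2 h')]
  -- the kernel `gA ζ = μ^ζ_I(A)` and its frozen version
  set gA : SpinConfig V → ℝ := fun ζ => ∫ σ, χ σ ∂(isingMeasure G I β h (.fixed ζ)) with hgA
  set P : SpinConfig V → SpinConfig V := fun η x => if x ∈ Λ then η x else ηbc x with hP
  set g : SpinConfig V → ℝ := fun η => gA (P η) with hg
  -- the boundary sites inside `Λ`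
  set T : Finset V := (outerBoundary G I).filter (· ∈ Λ) with hT
  -- `g` depends only on the spins in `T`
  have hgdep : ∀ η η' : SpinConfig V, (∀ y ∈ T, η y = η' y) → g η = g η' := by
    intro η η' hηη'
    simp only [hg, hgA]
    refine isingExpect_fixed_congr_outerBoundary G (fun y hy => ?_) β h hχm hχloc
    simp only [hP]
    by_cases hyΛ : y ∈ Λ
    · rw [if_pos hyΛ, if_pos hyΛ]
      exact hηη' y (Finset.mem_filter.2 ⟨hy, hyΛ⟩)
    · rw [if_neg hyΛ, if_neg hyΛ]
  -- hence `g` is `m''`-measurable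
  have hres : Measurable[m''] fun (η : SpinConfig V) (y : ↥T) => η y :=
    @measurable_pi_lambda _ _ _ m'' _ _ fun y => by
      obtain ⟨hy, hyΛ⟩ := Finset.mem_filter.1 y.2
      exact hbd y hy hyΛ
  let e : (↥T → ℤˣ) → SpinConfig V := fun ζ x => if hx : x ∈ T then ζ ⟨x, hx⟩ else 1
  have hfac : g = (g ∘ e) ∘ fun (η : SpinConfig V) (y : ↥T) => η y := by
    funext η
    simp only [Function.comp_apply]
    refine hgdep η _ fun y hy => ?_
    simp [e, hy]
  have hgm : StronglyMeasurable[m''] g := by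
    refine Measurable.stronglyMeasurable ?_
    rw [hfac]
    exact (measurable_of_countable (g ∘ e)).comp hres
  -- `g` is bounded by `1`
  have hgb : ∀ η, |g η| ≤ 1 := fun η => by
    simp only [hg, hgA]
    have := norm_integral_le_of_norm_le_const (μ := isingMeasure G I β h (.fixed (P η)))
      (C := 1) (f := χ) (ae_of_all _ fun σ => by rw [Real.norm_eq_abs]; exact hχb σ)
    simpa [Real.norm_eq_abs] using this
  -- `ν[1_A | 𝓕_{Iᶜ}] = gA` (finite-volume DLR) `= g` a.s. (freezing off `Λ`)
  have hDLR : ν[χ | cylinderEvents (X := fun _ : V => ℤˣ) ((↑I : Set V)ᶜ)] =ᵐ[ν] gA :=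
    condExp_isingMeasure_fixed_ae_eq_integral G hsub β h ηbc hχm hχb
  have hfreeze : gA =ᵐ[ν] g := by
    filter_upwards [ae_eqOn_compl_isingMeasure_fixed G Λ β h ηbc] with η hη
    simp only [hg]
    rw [show P η = η from freeze_eq_self_of_eqOn hη]
  exact ⟨g, hgm, ⟨1, hgb⟩, hDLR.trans hfreeze⟩

end IsingMarkov


/-! ### Lattice geometry at mesh `δ` -/

section Geometry

open Metric

variable {d : ℕ}

/-- `siteToE` of a unit step: `siteToE (x + eᵢ) = siteToE x + eᵢ`. [folklore] -/
theorem siteToE_add_single (x : Site d) (i : Fin d) :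
    siteToE (x + Pi.single i 1) = siteToE x + EuclideanSpace.single i (1 : ℝ) := by
  ext j
  rw [siteToE_apply, PiLp.add_apply, siteToE_apply, Pi.add_apply, PiLp.single_apply,
    Pi.single_apply]
  by_cases hj : j = i
  · subst hj; simp
  · simp [hj]

/-- Nearest neighbours of `ℤᵈ` are at Euclidean distance `1`. [folklore] -/
theorem dist_siteToE_of_adj {x y : Site d} (h : (zdGraph d).Adj x y) :
    dist (siteToE x) (siteToE y) = 1 := by
  obtain ⟨i, h | h⟩ := (zdGraph_adj_iff x y).1 h
  · rw [h, siteToE_add_single, dist_comm, dist_eq_norm, add_sub_cancel_left, PiLp.norm_single,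
      norm_one]
  · rw [h, siteToE_add_single, dist_eq_norm, add_sub_cancel_left, PiLp.norm_single, norm_one]

/-- At mesh `δ`, nearest neighbours of `δℤᵈ` are at distance `|δ|`. [folklore] -/
theorem dist_smul_siteToE_of_adj {x y : Site d} (h : (zdGraph d).Adj x y) (δ : ℝ) :
    dist (δ • siteToE x) (δ • siteToE y) = |δ| := by
  rw [dist_smul₀, dist_siteToE_of_adj h, mul_one, Real.norm_eq_abs]

/-- Distinct sites of `ℤᵈ` are at Euclidean distance at least `1`. [folklore] -/
theorem one_le_dist_siteToE_of_ne {x y : Site d} (h : x ≠ y) : 1 ≤ dist (siteToE x) (siteToE y) := by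
  obtain ⟨i, hi⟩ := Function.ne_iff.1 h
  have hzi : (1 : ℤ) ≤ |x i - y i| := Int.one_le_abs (sub_ne_zero.2 hi)
  calc (1 : ℝ) ≤ |((x i : ℤ) : ℝ) - ((y i : ℤ) : ℝ)| := by exact_mod_cast hzi
    _ = dist (siteToE x i) (siteToE y i) := by rw [siteToE_apply, siteToE_apply, Real.dist_eq]
    _ ≤ dist (siteToE x) (siteToE y) := PiLp.dist_apply_le _ _ i

/-- At mesh `δ ≥ 0`, distinct sites of `δℤᵈ` are at distance at least `δ`. [folklore] -/
theorem le_dist_smul_siteToE_of_ne {x y : Site d} (h : x ≠ y) {δ : ℝ} (hδ : 0 ≤ δ) :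
    δ ≤ dist (δ • siteToE x) (δ • siteToE y) := by
  rw [dist_smul₀, Real.norm_eq_abs, abs_of_nonneg hδ]
  simpa using mul_le_mul_of_nonneg_left (one_le_dist_siteToE_of_ne h) hδ

/-- A Schwartz bump: for every point `p` of `ℝᵈ` and radius `R > 0` there is a real Schwartz function
supported in `B(p, R)` and non-zero at `p` (a `ContDiffBump`; smooth compactly supported functions are
Schwartz, Mathlib `HasCompactSupport.toSchwartzMap`). [folklore] -/
theorem exists_schwartz_tsupport_subset_ball (p : EuclideanSpace ℝ (Fin d)) {R : ℝ} (hR : 0 < R) :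
    ∃ f : 𝓢(EuclideanSpace ℝ (Fin d), ℝ), tsupport f ⊆ ball p R ∧ f p ≠ 0 := by
  let b : ContDiffBump p := ⟨R / 4, R / 2, by positivity, by linarith⟩
  refine ⟨b.hasCompactSupport.toSchwartzMap b.contDiff, ?_, ?_⟩
  · intro x hx
    have hx' : x ∈ tsupport b := hx
    rw [b.tsupport_eq] at hx'
    exact closedBall_subset_ball (by show R / 2 < R; linarith) hx'
  · show b p ≠ 0
    rw [b.one_of_mem_closedBall (mem_closedBall_self (by show (0:ℝ) ≤ R / 4; positivity))]
    exact one_ne_zero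

end Geometry

/-! ### Pull-backs of the local σ-algebras of `𝓢'(ℝᵈ)` along the lattice spin field -/

section Pullback

open Metric

variable {d : ℕ}

/-- `Φ_δ(f) = ρ δᵈ ∑_{x ∈ Λ} σ_x f(δx)` for the smeared spin field. [folklore] -/
theorem spinField_apply (Λ : Finset (Site d)) (δ ρ : ℝ) (σ : SpinConfig (Site d))
    (f : 𝓢(EuclideanSpace ℝ (Fin d), ℝ)) :
    spinField Λ δ ρ σ f = ∑ x ∈ Λ, ρ * δ ^ d * spinAt x σ * f (δ • siteToE x) := by
  rw [spinField, finLatticeField_apply]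

/-- A single spin is measurable for the cylinder σ-algebra of any set of sites containing it.
[folklore] -/
theorem measurable_spinAt_cylinderEvents {Δ : Set (Site d)} {x : Site d} (hx : x ∈ Δ) :
    Measurable[cylinderEvents (X := fun _ : Site d => ℤˣ) Δ] (spinAt x : SpinConfig (Site d) → ℝ) :=
  (Measurable.of_discrete (f := fun u : ℤˣ => ((u : ℤ) : ℝ))).comp
    (measurable_cylinderEvent_apply (X := fun _ : Site d => ℤˣ) hx)

/-- The evaluation `σ ↦ Φ_δ(σ)(f)` of the smeared spin field at a test function supported in `U` is
measurable with respect to the spins at the sites of `Λ` sent into `U` by `x ↦ δx` (the other terms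
of the finite sum vanish). [folklore] -/
theorem measurable_spinField_eval_cylinderEvents (Λ : Finset (Site d)) (δ ρ : ℝ)
    {U : Set (EuclideanSpace ℝ (Fin d))} {f : 𝓢(EuclideanSpace ℝ (Fin d), ℝ)}
    (hf : tsupport f ⊆ U) :
    Measurable[cylinderEvents (X := fun _ : Site d => ℤˣ) {x | x ∈ Λ ∧ δ • siteToE x ∈ U}]
      fun σ : SpinConfig (Site d) => spinField Λ δ ρ σ f := by
  have heq : (fun σ : SpinConfig (Site d) => spinField Λ δ ρ σ f) =
      fun σ => ∑ x ∈ Λ, ρ * δ ^ d * spinAt x σ * f (δ • siteToE x) :=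
    funext fun σ => spinField_apply Λ δ ρ σ f
  rw [heq]
  refine Finset.measurable_sum _ fun x hx => ?_
  by_cases hxU : δ • siteToE x ∈ U
  · have hmem : x ∈ {x | x ∈ Λ ∧ δ • siteToE x ∈ U} := ⟨hx, hxU⟩
    exact ((measurable_spinAt_cylinderEvents hmem).const_mul _).mul_const _
  · have h0 : f (δ • siteToE x) = 0 := image_eq_zero_of_notMem_tsupport fun h => hxU (hf h)
    simp only [h0, mul_zero]
    exact measurable_const

/-- **Pull-back of the events seen in `U`**: along the smeared spin field `Φ_δ`, the σ-algebra
`extEvents U` of `𝓢'(ℝᵈ)` pulls back into the σ-algebra of the spins at the sites `x ∈ Λ` with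
`δx ∈ U`. [folklore] -/
theorem comap_spinField_extEvents_le (Λ : Finset (Site d)) (δ ρ : ℝ)
    (U : Set (EuclideanSpace ℝ (Fin d))) :
    (extEvents U).comap (spinField Λ δ ρ) ≤
      cylinderEvents (X := fun _ : Site d => ℤˣ) {x | x ∈ Λ ∧ δ • siteToE x ∈ U} := by
  simp only [extEvents, MeasurableSpace.comap_iSup, MeasurableSpace.comap_comp]
  refine iSup₂_le fun f hf => ?_
  exact (measurable_spinField_eval_cylinderEvents Λ δ ρ hf).comap_le

/-- If a test function vanishes at all mesh points `δx`, `x ∈ Λ ∖ {y}`, the smeared spin field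
evaluated at it is `ρ δᵈ σ_y f(δy)`. [folklore] -/
theorem spinField_apply_of_isolated (Λ : Finset (Site d)) (δ ρ : ℝ) {y : Site d} (hy : y ∈ Λ)
    {f : 𝓢(EuclideanSpace ℝ (Fin d), ℝ)} (hf : ∀ x ∈ Λ, x ≠ y → f (δ • siteToE x) = 0)
    (σ : SpinConfig (Site d)) :
    spinField Λ δ ρ σ f = ρ * δ ^ d * spinAt y σ * f (δ • siteToE y) := by
  rw [spinField_apply, Finset.sum_eq_single y (fun x hx hxy => by rw [hf x hx hxy, mul_zero])
    (fun h => (h hy).elim)]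

/-- **Isolating a spin by a test function**: if `ρ ≠ 0`, `δ ≠ 0` and a test function `f` supported in
`U` vanishes at the mesh points `δx`, `x ∈ Λ ∖ {y}`, but not at `δy` (`y ∈ Λ`), then the spin at `y`
is measurable for the pull-back of `extEvents U` along `Φ_δ` (`σ_y = Φ_δ(σ)(f) / (ρ δᵈ f(δy))`).
[folklore] -/
theorem measurable_apply_comap_spinField (Λ : Finset (Site d)) {δ ρ : ℝ} (hδ : δ ≠ 0) (hρ : ρ ≠ 0)
    {U : Set (EuclideanSpace ℝ (Fin d))} {y : Site d} (hy : y ∈ Λ)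
    {f : 𝓢(EuclideanSpace ℝ (Fin d), ℝ)} (hfU : tsupport f ⊆ U)
    (hf : ∀ x ∈ Λ, x ≠ y → f (δ • siteToE x) = 0) (hfy : f (δ • siteToE y) ≠ 0) :
    Measurable[(extEvents U).comap (spinField Λ δ ρ)] fun η : SpinConfig (Site d) => η y := by
  set m := (extEvents U).comap (spinField Λ δ ρ) with hm
  have h1 : Measurable[m] fun σ : SpinConfig (Site d) => spinField Λ δ ρ σ f :=
    @Measurable.comp _ _ _ m (extEvents U) _ _ _ (measurable_eval_of_tsupport_subset hfU)
      (comap_measurable (spinField Λ δ ρ))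
  have hc : ρ * δ ^ d * f (δ • siteToE y) ≠ 0 :=
    mul_ne_zero (mul_ne_zero hρ (pow_ne_zero _ hδ)) hfy
  have h2 : Measurable[m] (spinAt y : SpinConfig (Site d) → ℝ) := by
    have heq : (spinAt y : SpinConfig (Site d) → ℝ) =
        fun σ => spinField Λ δ ρ σ f / (ρ * δ ^ d * f (δ • siteToE y)) := by
      funext σ
      rw [spinField_apply_of_isolated Λ δ ρ hy hf σ, eq_div_iff hc]
      ring
    rw [heq]
    exact h1.div_const _
  have h3 : MeasurableSet[m] ((spinAt y : SpinConfig (Site d) → ℝ) ⁻¹' {1}) :=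
    h2 (measurableSet_singleton 1)
  have heq : (fun η : SpinConfig (Site d) => η y) =
      fun η => if spinAt y η = 1 then (1 : ℤˣ) else -1 := by
    funext η
    rcases Int.units_eq_one_or (η y) with h | h
    · simp [spinAt, h]
    · have hs : spinAt y η = -1 := by simp [spinAt, h]
      rw [hs, if_neg (by norm_num), h]
  rw [heq]
  exact Measurable.ite h3 measurable_const measurable_const

end Pullback

/-! ### The thick-shell Markov property of the lattice spin field -/

section ShellMarkov

open Metric

variable {d : ℕ}

/-- **Lattice spin fields are Markov across every spherical shell thicker than the mesh.** Let
`ν = μ^{ηbc}_{Λ;β,h}` be the finite-volume Ising measure of `ℤᵈ` in `Λ` with fixed boundary condition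
`ηbc` (any real `β`, `h`), `0 < δ < ε`, `ρ ≠ 0`, and `μ_δ = ν ∘ Φ_δ⁻¹` the law on `𝓢'(ℝᵈ)` of the
smeared spin field `Φ_δ = ρ δᵈ ∑_{x ∈ Λ} σ_x δ_{δx}` (`spinFieldLaw`). Then for every centre `c` and
radius `r` the events inside the open ball `B(c, r)` and the events outside the closed ball
`B̄(c, r + ε/2)` are conditionally independent under `μ_δ` given the events in the open shell
`B(c, r + ε) ∖ B̄(c, r)`. Proof: with `I = {x ∈ Λ : |δx − c| ≤ r}`, interior events pull back to
`I`-local events, exterior and shell events to events off `I`, and every site of `∂ᵉˣI ∩ Λ` lies at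
radius in `(r, r + δ] ⊆ (r, r + ε)`, where a Schwartz bump of radius `< δ` isolates its spin, so the
shell events see the boundary spins; conclude by the Markov property of `ν` across `I`
(`condIndepCondExp_isingMeasure_fixed`, Friedli–Velenik 2017, eq. (3.26)) transported along `Φ_δ`
(`CondIndepCondExp.map_of_comap`). [cite: FriedliVelenik2017, Exercise 3.11, eq. (3.26)] -/
theorem condIndepCondExp_shell_spinFieldLaw_isingMeasure (Λ : Finset (Site d)) (β h : ℝ)
    (ηbc : SpinConfig (Site d)) {δ ρ : ℝ} (hδ : 0 < δ) (hρ : ρ ≠ 0) (c : EuclideanSpace ℝ (Fin d))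
    (r ε : ℝ) (hδε : δ < ε) :
    CondIndepCondExp (extEvents (ball c (r + ε) \ closedBall c r)) (extEvents (ball c r))
      (extEvents (closedBall c (r + ε / 2))ᶜ)
      (spinFieldLaw (isingMeasure (zdGraph d) Λ β h (.fixed ηbc)) Λ δ ρ) := by
  classical
  have hε : 0 < ε := hδ.trans hδε
  rw [spinFieldLaw]
  refine CondIndepCondExp.map_of_comap (measurable_spinField Λ δ ρ) (extEvents_le _)
    (extEvents_le _) (extEvents_le _) ?_
  set I : Finset (Site d) := Λ.filter fun x => dist (δ • siteToE x) c ≤ r with hI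
  have hsub : I ⊆ Λ := Finset.filter_subset _ _
  have hmemI : ∀ {x : Site d}, x ∈ I ↔ x ∈ Λ ∧ dist (δ • siteToE x) c ≤ r := fun {x} => by
    rw [hI, Finset.mem_filter]
  refine condIndepCondExp_isingMeasure_fixed (zdGraph d) hsub β h ηbc ?_ ?_ ?_ ?_
  · -- shell events pull back to events off `I`
    refine (comap_spinField_extEvents_le Λ δ ρ _).trans (cylinderEvents_mono ?_)
    rintro x ⟨-, hxU⟩ hxI
    exact hxU.2 (mem_closedBall.2 (hmemI.1 (Finset.mem_coe.1 hxI)).2)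
  · -- the boundary spins of `I` inside `Λ` are seen by the shell events
    intro y hy hyΛ
    obtain ⟨hyI, x, hxI, hadj⟩ := mem_outerBoundary_iff.1 hy
    have hxr : dist (δ • siteToE x) c ≤ r := (hmemI.1 hxI).2
    have hyr : r < dist (δ • siteToE y) c := by
      by_contra hle
      exact hyI (hmemI.2 ⟨hyΛ, not_lt.1 hle⟩)
    have hyshell : δ • siteToE y ∈ ball c (r + ε) \ closedBall c r := by
      refine ⟨mem_ball.2 ?_, fun h' => (not_le.2 hyr) (mem_closedBall.1 h')⟩
      calc dist (δ • siteToE y) c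
          ≤ dist (δ • siteToE y) (δ • siteToE x) + dist (δ • siteToE x) c := dist_triangle _ _ _
        _ = |δ| + dist (δ • siteToE x) c := by rw [dist_smul_siteToE_of_adj hadj]
        _ ≤ δ + r := by rw [abs_of_pos hδ]; linarith
        _ < r + ε := by linarith
    have hopen : IsOpen (ball c (r + ε) \ closedBall c r) := isOpen_ball.sdiff isClosed_closedBall
    obtain ⟨R, hR, hRsub⟩ := Metric.isOpen_iff.1 hopen _ hyshell
    obtain ⟨f, hfsupp, hfy⟩ :=
      exists_schwartz_tsupport_subset_ball (δ • siteToE y) (lt_min hR hδ)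
    refine measurable_apply_comap_spinField Λ hδ.ne' hρ hyΛ
      (hfsupp.trans ((ball_subset_ball (min_le_left _ _)).trans hRsub)) (fun x _ hxy => ?_) hfy
    refine image_eq_zero_of_notMem_tsupport fun hx => ?_
    have h1 : dist (δ • siteToE x) (δ • siteToE y) < min R δ := mem_ball.1 (hfsupp hx)
    have h2 : δ ≤ dist (δ • siteToE x) (δ • siteToE y) := le_dist_smul_siteToE_of_ne hxy hδ.le
    exact absurd (h1.trans_le (min_le_right _ _)) (not_lt.2 h2)
  · -- interior events pull back to `I`-local events
    refine (comap_spinField_extEvents_le Λ δ ρ _).trans (cylinderEvents_mono ?_)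
    rintro x ⟨hxΛ, hxU⟩
    exact Finset.mem_coe.2 (hmemI.2 ⟨hxΛ, (mem_ball.1 hxU).le⟩)
  · -- exterior events pull back to events off `I`
    refine (comap_spinField_extEvents_le Λ δ ρ _).trans (cylinderEvents_mono ?_)
    rintro x ⟨-, hxU⟩ hxI
    have hxr := (hmemI.1 (Finset.mem_coe.1 hxI)).2
    exact hxU (mem_closedBall.2 (by linarith))

end ShellMarkov

end Literature.MathematicalPhysics.QuantumLattice

end
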